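/-
Copyright (c) 2026 the pub-hodgecm-mathlib formalisation cell (harness21).  Prover seat hodgecm-mathlib-K2E4-p18 (g4), Track B «K2-LIT» ∕ h413
(stmt-HodgeConjecture-24833), ‹S› ROAD J ∕ R3 «RANK-ONE MASS», letter D (r): brick (D-a-ram) «DOCK BLOCK MODEL AT A RAMIFIED ODD PLACE»
(K2E3-p03 (g2) deal 2026-09-04T02:08:41Z; head = the (D-a) contract `K2/K2E3-p15/g3/HEADS-letterD.K2E3-p15-g3.lean` :29 of K2E3-p15 (g3) with `hunr` traded
for a GLOBAL UNIT NON-NORM `ξ₀`).  2026-09-04.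
-/
import Summits.HodgeConjecture.HodgeConjecture.Theorems.K2E3DockInvariantForm            -- ★ F3a K2E4-p13 p856517: `exists_formCongr_dock_eq` (the dock conjugator is a block similitude); dock currency
import Summits.HodgeConjecture.HodgeConjecture.Theorems.K2E3CompactSheetBlockModelKit     -- ★ R3g kit K2E4-p07 p856451 (import closure: `finSum` algebra, `toLocalRing`, `formCongr`)
import Literature.NumberTheory.Automorphic.QuadraticLocalNormGroupNonsplit                -- ★ `exists_norm_mul_of_not_exists_norm` (local norm index two at a non-split place)
import Literature.NumberTheory.Automorphic.HeisenbergChartAtNonsplitPlace                -- ★ `conjLocal_apply_eq_of_smul_eq` (closure), `valued_galAdicCompletionMap`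
import Literature.NumberTheory.Automorphic.GodementHeightFloor                           -- ★ `Godement.det_ne_zero_of_anisotropic`
import Literature.NumberTheory.Rogawski1990.ExplicitFactorRationalLocalisation           -- ★ `adelicForm_map_adeleToLocal`, `conjLocal_algebraMap`
import Literature.NumberTheory.Weil1982.UnitaryFinCentralizerTopFormHaar                  -- ★ `UnitaryFinTopForm.mat`
import Literature.NumberTheory.Rogawski1990.KottwitzSignTwistedPlane                   -- ★ `finSum_two_one_eq` (`B ⊕ᶠ C` in coordinates)
import HarnessLib

/-!
# ‹S› road J ∕ R3, letter D (r) — (D-a-ram) «DOCK BLOCK MODEL AT A RAMIFIED ODD PLACE»: the central dock `θ = Ad(y) ∘ ι_v` is, after a block rescaling, the scalar-`1`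
# congruence `φ_T` from the GLOBAL block form `c₂Φ₂ ⊕ᶠ c₁Φ₁`, `c₂, c₁ ∈ {1, ξ₀}` (Rogawski 1990 §4.8 Case (a) p. 53, §8.1 p. 116, §3.5 Prop. 3.5.2 (a) p. 29)

Cell `pub/hodgecm-mathlib`, Track B «K2-LIT», crux H413 = `stmt-HodgeConjecture-24833`; ‹S› ROAD J, letter ‹J3› v2 `sig_K2E3CompatibleMeasureEPIdentityRankOne`, residue class
(J3r) (ramified odd), payer road R3 «RANK-ONE MASS» (owner K2E3-p15 (g3); (r)-class K2E3-p03 (g2)).  THEOREMS ONLY (no definition, no instance, no notation, no `sorry`);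
lane `--supports stmt-HodgeConjecture-24833 --as helper`.

THE THEOREM **`exists_blockModel_dock_ramified`** = the (D-a) head `exists_blockModel_dock` of K2E3-p15 (g3)'s letter-D contract TOKEN FOR TOKEN, with the single trade
`hunr ↦ (ξ₀ : L) (hξc) (hξ1) (hξN)`: instead of «`v` unramified» (where the global uniformizer `ϖ_v` represents the non-trivial norm class), the INPUT is a global
`ξ₀ ∈ L⁺` which at `w` is a UNIT and NOT A NORM — in the valuation currency of ★ S4 (r) `K2E3CompactSheetMassRamified` ∕ ★ (U5) `RamifiedPlaceUnitNorms`: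
`|ξ₀|_w = 1` and `|σ_w(u)·u − ξ₀|_w = 1` for every unit `u` of `L_w`.  Such a `ξ₀` exists exactly when `w ∣ v` is ramified (★ (U2)
`exists_fixed_unit_not_norm_of_ramified_complexConj` + density; K2E3-p03's kit lemma `exists_global_unit_not_norm_of_ramified`), and it is the SAME `ξ₀` that frames the
compact sheet in the (r) block model, so the (r) assembly feeds one `ξ₀` to both sides.  OUTPUT = the (D-a) output binders
`(c₂ c₁ hc₂ hc₁ hc₂c hc₁c T hT x hau hx hxε hinter)` consumed by (D-b) `measure_level_prod_univ_eq_of_dockBlockModel` (K2E4-p14 (g3), place-generic), PLUS the membership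
`c₂, c₁ ∈ {1, ξ₀}` (so at a ramified place the dock blocks `c₂ • Φ₂`, `c₁ • Φ₁` are scaled by UNITS at `w`).

THE MATHEMATICS ([Rogawski1990, §4.8 Case (a) p. 53; §8.1 p. 116]; [PlatonovRapinchuk1994, §2.3]; norm index two [Rogawski1990, §3.5 Prop. 3.5.2 (a) p. 29],
[Omeara1963, §63B Prop. 63:13]; [Serre1979, Ch. V §3]).  Let `θ : H_v ≃ₜ* Z(ε)` be a central dock, `↑(θ z) = y · ι_v(z) · y⁻¹`.  By ★ F3a the form `ᵗ(σy)·H′_v·y` is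
`(0 0 λ; 0 μ 0; λ 0 0)` with `σλ = λ`, `σμ = μ`, units (`det H′ ≠ 0`).  At a non-split `v` the `σ`-fixed units of `L ⊗ L⁺_v = L_w` modulo norms `σ(z)·z` have order two (★
`exists_norm_mul_of_not_exists_norm`), and `ι(ξ₀)` is a non-norm (§2 `not_exists_norm_algebraMap_of_valued`), so `λ = N(z₂)·ι(c₂)`, `μ = N(z₁)·ι(c₁)` with `cᵢ ∈ {1, ξ₀}`;
put `sᵢ := zᵢ⁻¹` (`σ(s₂)·λ·s₂ = ι c₂`, `σ(s₁)·μ·s₁ = ι c₁`) and `M := ι(s₂·1₂, s₁)·W = (s₂ 0 0; 0 0 s₁; 0 s₂ 0)` (`W` the coordinate swap `2 ↔ 3`).  Then `T := y·M` has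
`ᵗ(σT)·H′_v·T = ᵗ(σM)·(0 0 λ; 0 μ 0; λ 0 0)·M = (0 c₂ 0; c₂ 0 0; 0 0 c₁) = (c₂Φ₂ ⊕ᶠ c₁Φ₁)_v` (§1 `transpose_map_rescale_mul_dockForm_mul_rescale`); `x := φ_T⁻¹ ε` has matrix
`M⁻¹·(y⁻¹ ε y)·M = M⁻¹·diag(a, u, a)·M = diag(a, a, u) = a·1₂ ⊕ᶠ u·1₁` (§1 `rescaleInv_mul_diagonal_mul_rescale`; `ι_v(ε_H) = diag(a, u, a)` ★
`coe_coe_endoEmbLocal_of_fst_eq_smul_one`); and for `mat g = z.1 ⊕ᶠ z.2`: `T·g·T⁻¹ = y·(M (z.1 ⊕ᶠ z.2) M⁻¹)·y⁻¹ = y·ι_v(z)·y⁻¹ = ↑(θ z)` (§1 `rescale_mul_finSum_mul_rescaleInv`: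
the block scalars `s₂, s₁` commute with `ι_v(z)`).  `a − u` is a unit since `L_w` is a field (★ `isUnit_sub_of_ne_of_smul_eq`).

* §1 (any group ∕ commutative ring): two frame-conjugation identities; the rescaling matrix `M(s₂, s₁)`, its inverse, and the three conjugation identities (★ `finSum_two_one_eq`).
* §2 (CM, non-split `w ∣ v`): `not_exists_norm_algebraMap_of_valued` (valuation currency ⇒ algebraic non-norm), `exists_rescale_of_conjLocal_eq` (every `σ`-fixed unit is
  `N(s⁻¹)·ι(c)`, `c ∈ {1, ξ₀}` global), `isUnit_dockForm_entries` (`λ, μ` are units).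
* §3 **`exists_blockModel_dock_ramified`** (the head).

HONEST LABEL: HC_CM is proved only modulo the 7 printed citations (2 remaining named inputs: hLiu418 = `stmt-HodgeConjecture-24832`, h413 = `stmt-HodgeConjecture-24833`) until
rung 0 closes; this file is a count-neutral helper (local linear algebra + local class field theory of a quadratic extension); ‹J3› is NOT proved here.

## References
* [Rogawski1990] J. D. Rogawski, *Automorphic Representations of Unitary Groups in Three Variables*, Ann. of Math. Stud. 123 (1990), §4.8 Case (a) p. 53 (the embedding `ι`),
  §8.1 p. 116 («compatible measures»), §3.5 Prop. 3.5.2 (a) p. 29 (`H¹(F, T) ≅ F^× ∕ N E^×`), §3.8 Prop. 3.8.1 (a) p. 30.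
* [PlatonovRapinchuk1994] V. Platonov, A. Rapinchuk, *Algebraic Groups and Number Theory* (1994), §2.3 (similitudes and change of basis for hermitian forms).
* [Omeara1963] O. T. O'Meara, *Introduction to Quadratic Forms* (1963), §63B Prop. 63:13 (local norm index two).
* [Serre1979] J.-P. Serre, *Local Fields*, GTM 67 (1979), Ch. V §3 Prop. 5, Cor. 2 (unit norms at a tamely ramified quadratic place).
-/

set_option autoImplicit false
set_option linter.dupNamespace false

noncomputable section

open NumberField IsDedekindDomain Matrix
open Literature.NumberTheory.Automorphic Literature.NumberTheory.Automorphic.UnitaryGroup Literature.NumberTheory.Rogawski1990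
open Literature.NumberTheory.Weil1982.UnitaryFinTopForm
open scoped MatrixGroups Matrix

namespace Summit.HodgeConjecture.HodgeConjecture.Cruxes.H413.K2E3DockBlockModelRamified

/-! ## §1 The rescaling matrix `M(s₂, s₁) = ι(s₂·1₂, s₁)·W` over a commutative ring -/

section Algebra

variable {R : Type*} [CommRing R] (σ : R →+* R)

/-- Reading a point through a composite frame: `(yM)·X·(yM)⁻¹ = ε = y·ι·y⁻¹ ⇒ X = M⁻¹·ι·M`. [folklore] -/
theorem eq_conj_of_frame_conj_eq {G : Type*} [Group G] {y M X e i : G} (h1 : y * M * X * (y * M)⁻¹ = e) (h2 : e = y * i * y⁻¹) :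
    X = M⁻¹ * i * M := by
  have h : X = (y * M)⁻¹ * e * (y * M) := by rw [← h1]; group
  rw [h, h2]; group

/-- Conjugation by a composite frame: `(yM)·g·(yM)⁻¹ = y·(M g M⁻¹)·y⁻¹`. [folklore] -/
theorem frame_mul_conj_eq {G : Type*} [Group G] (y M g : G) : y * M * g * (y * M)⁻¹ = y * (M * g * M⁻¹) * y⁻¹ := by group

/-- `M(s₂, s₁) · M′(t₂, t₁) = 1` for `s₂ t₂ = 1`, `s₁ t₁ = 1`, where `M = (s₂ 0 0; 0 0 s₁; 0 s₂ 0)`, `M′ = (t₂ 0 0; 0 0 t₂; 0 t₁ 0)`. [cite: PlatonovRapinchuk1994, §2.3] -/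
theorem rescale_mul_rescaleInv {s₂ t₂ s₁ t₁ : R} (h₂ : s₂ * t₂ = 1) (h₁ : s₁ * t₁ = 1) :
    (!![s₂, 0, 0; 0, 0, s₁; 0, s₂, 0] : Matrix (Fin 3) (Fin 3) R) * !![t₂, 0, 0; 0, 0, t₂; 0, t₁, 0] = 1 := by
  ext i j
  fin_cases i <;> fin_cases j <;> simp [Matrix.mul_apply, Fin.sum_univ_three, h₂, h₁]

/-- `M′(t₂, t₁) · M(s₂, s₁) = 1` for `s₂ t₂ = 1`, `s₁ t₁ = 1`. [cite: PlatonovRapinchuk1994, §2.3] -/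
theorem rescaleInv_mul_rescale {s₂ t₂ s₁ t₁ : R} (h₂ : s₂ * t₂ = 1) (h₁ : s₁ * t₁ = 1) :
    (!![t₂, 0, 0; 0, 0, t₂; 0, t₁, 0] : Matrix (Fin 3) (Fin 3) R) * !![s₂, 0, 0; 0, 0, s₁; 0, s₂, 0] = 1 := by
  have h₂' : t₂ * s₂ = 1 := by rw [mul_comm]; exact h₂
  have h₁' : t₁ * s₁ = 1 := by rw [mul_comm]; exact h₁
  ext i j
  fin_cases i <;> fin_cases j <;> simp [Matrix.mul_apply, Fin.sum_univ_three, h₂', h₁']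

/-- **The rescaled dock form**: `ᵗ(σM)·(0 0 λ; 0 μ 0; λ 0 0)·M = (0 c₂ 0; c₂ 0 0; 0 0 c₁)` with `c₂ = σ(s₂)·λ·s₂`, `c₁ = σ(s₁)·μ·s₁` — the form `endoForm(λΦ₂, μ)` carried by
`M = ι(s₂·1₂, s₁)·W` to `c₂Φ₂ ⊕ᶠ c₁Φ₁`. [cite: Rogawski1990, §4.8 Case (a) p. 53] [cite: PlatonovRapinchuk1994, §2.3] -/
theorem transpose_map_rescale_mul_dockForm_mul_rescale (s₂ s₁ lam mu : R) :
    ((!![s₂, 0, 0; 0, 0, s₁; 0, s₂, 0] : Matrix (Fin 3) (Fin 3) R).map σ)ᵀ * !![0, 0, lam; 0, mu, 0; lam, 0, 0] * !![s₂, 0, 0; 0, 0, s₁; 0, s₂, 0] =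
      !![0, σ s₂ * lam * s₂, 0; σ s₂ * lam * s₂, 0, 0; 0, 0, σ s₁ * mu * s₁] := by
  ext i j
  fin_cases i <;> fin_cases j <;> simp [Matrix.mul_apply, Fin.sum_univ_three, Matrix.transpose_apply, Matrix.map_apply]

/-- **The rescaling fixes the central point**: `M′·diag(a, u, a)·M = diag(a, a, u)` (`= a·1₂ ⊕ᶠ u·1₁`). [cite: Rogawski1990, §4.8 Case (a) p. 53; §8.1 p. 116] -/
theorem rescaleInv_mul_diagonal_mul_rescale {s₂ t₂ s₁ t₁ : R} (h₂ : s₂ * t₂ = 1) (h₁ : s₁ * t₁ = 1) (a u : R) :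
    (!![t₂, 0, 0; 0, 0, t₂; 0, t₁, 0] : Matrix (Fin 3) (Fin 3) R) * !![a, 0, 0; 0, u, 0; 0, 0, a] * !![s₂, 0, 0; 0, 0, s₁; 0, s₂, 0] =
      !![a, 0, 0; 0, a, 0; 0, 0, u] := by
  have hA : ∀ x : R, t₂ * x * s₂ = x := fun x => by rw [mul_right_comm, mul_comm t₂, h₂, one_mul]
  have hB : ∀ x : R, t₁ * x * s₁ = x := fun x => by rw [mul_right_comm, mul_comm t₁, h₁, one_mul]
  ext i j
  fin_cases i <;> fin_cases j <;> simp [Matrix.mul_apply, Fin.sum_univ_three, hA, hB]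

/-- **The rescaling intertwines `z.1 ⊕ᶠ z.2` with `ι(z)`**: `M·(B ⊕ᶠ C)·M′ = (B₀₀ 0 B₀₁; 0 C₀₀ 0; B₁₀ 0 B₁₁)` — `W` conjugates `B ⊕ᶠ C` to `ι(B, C)` and the block scalars
`ι(s₂·1₂, s₁)` commute with `ι(B, C)`. [cite: Rogawski1990, §4.8 Case (a) p. 53] -/
theorem rescale_mul_finSum_mul_rescaleInv {s₂ t₂ s₁ t₁ : R} (h₂ : s₂ * t₂ = 1) (h₁ : s₁ * t₁ = 1) (B : Matrix (Fin 2) (Fin 2) R) (C : Matrix (Fin 1) (Fin 1) R) :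
    (!![s₂, 0, 0; 0, 0, s₁; 0, s₂, 0] : Matrix (Fin 3) (Fin 3) R) * finSum 2 1 B C * !![t₂, 0, 0; 0, 0, t₂; 0, t₁, 0] =
      !![B 0 0, 0, B 0 1; 0, C 0 0, 0; B 1 0, 0, B 1 1] := by
  have hA : ∀ x : R, s₂ * x * t₂ = x := fun x => by rw [mul_right_comm, h₂, one_mul]
  have hB : ∀ x : R, s₁ * x * t₁ = x := fun x => by rw [mul_right_comm, h₁, one_mul]
  rw [finSum_two_one_eq]
  ext i j
  fin_cases i <;> fin_cases j <;> simp [Matrix.mul_apply, Fin.sum_univ_three, hA, hB]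

/-- `a·1₂ ⊕ᶠ u·1₁ = diag(a, a, u)`. [folklore] -/
theorem finSum_smul_one_smul_one (a u : R) :
    finSum 2 1 (a • (1 : Matrix (Fin 2) (Fin 2) R)) (u • (1 : Matrix (Fin 1) (Fin 1) R)) = !![a, 0, 0; 0, a, 0; 0, 0, u] := by
  rw [finSum_two_one_eq]
  ext i j
  fin_cases i <;> fin_cases j <;> simp

/-- `(0 p; p 0) ⊕ᶠ (e) = (0 p 0; p 0 0; 0 0 e)` — the local Gram matrix of `c₂Φ₂ ⊕ᶠ c₁Φ₁`. [cite: Rogawski1990, §4.8 Case (a) p. 53] -/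
theorem finSum_antidiag_two_one (p e : R) : finSum 2 1 !![0, p; p, 0] !![e] = !![0, p, 0; p, 0, 0; 0, 0, e] := by
  rw [finSum_two_one_eq]
  ext i j
  fin_cases i <;> fin_cases j <;> simp

/-- **A frame followed by a change of basis**: `ᵗσ(TS)·H·(TS) = ᵗ(σS)·(ᵗ(σT)·H·T)·S`. [cite: PlatonovRapinchuk1994, §2.3] -/
theorem formCongr_mul_eq (T S : GL (Fin 3) R) (H : Matrix (Fin 3) (Fin 3) R) :
    formCongr σ (T * S) H = ((S.val).map σ)ᵀ * formCongr σ T H * S.val := by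
  simp only [formCongr, Units.val_mul, Matrix.map_mul, Matrix.transpose_mul, Matrix.mul_assoc]

/-- The determinant of an invertible congruent form is a unit: `det(ᵗ(σT)·H·T) ∈ R^×` when `det H ∈ R^×`. [cite: PlatonovRapinchuk1994, §2.3] -/
theorem isUnit_det_formCongr (T : GL (Fin 3) R) {H : Matrix (Fin 3) (Fin 3) R} (hH : IsUnit H.det) : IsUnit (formCongr σ T H).det := by
  have h : (formCongr σ T H).det = σ T.val.det * H.det * T.val.det := by
    simp only [formCongr, Matrix.det_mul, Matrix.det_transpose, ← RingHom.mapMatrix_apply, ← RingHom.map_det]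
  rw [h]
  exact (((Matrix.isUnits_det_units T).map σ).mul hH).mul (Matrix.isUnits_det_units T)

/-- The entries `λ, μ` of an invertible dock form `(0 0 λ; 0 μ 0; λ 0 0)` are units (`det = −λ²μ`). [cite: Rogawski1990, §4.8 Case (a) p. 53] -/
theorem isUnit_dockForm_entries {lam mu : R} (h : IsUnit (!![0, 0, lam; 0, mu, 0; lam, 0, 0] : Matrix (Fin 3) (Fin 3) R).det) : IsUnit lam ∧ IsUnit mu := by
  have hdet : (!![0, 0, lam; 0, mu, 0; lam, 0, 0] : Matrix (Fin 3) (Fin 3) R).det = -(lam * (mu * lam)) := by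
    rw [Matrix.det_fin_three]
    simp only [Matrix.of_apply, Matrix.cons_val', Matrix.cons_val_zero, Matrix.cons_val_one, Matrix.cons_val_two, Matrix.empty_val', Matrix.cons_val_fin_one,
      Matrix.head_cons, Matrix.tail_cons, Matrix.head_fin_const]
    ring
  rw [hdet, IsUnit.neg_iff] at h
  exact ⟨isUnit_of_mul_isUnit_left h, isUnit_of_mul_isUnit_left (isUnit_of_mul_isUnit_right h)⟩

end Algebra

/-! ## §2 The CM place: the global unit non-norm `ξ₀` and the block rescaling by norm index two -/

section Place

variable (L : Type) [Field L] [NumberField L] [IsCMField L] (v : HeightOneSpectrum (𝓞 ↥(maximalRealSubfield L)))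
  (w : PlacesOver L v) (hw : IsCMField.complexConj L • w.1 = w.1)
  {ξ₀ : L} (hξ1 : Valued.v (algebraMap L (w.1.adicCompletion L) ξ₀) = 1)
  (hξN : ∀ u : w.1.adicCompletion L, Valued.v u = 1 →
    Valued.v (galAdicCompletionMap (L := L) (IsCMField.complexConj L) hw u * u - algebraMap L (w.1.adicCompletion L) ξ₀) = 1)

include hξ1 in
omit [IsCMField L] in
/-- `|ξ₀|_w = 1 ⇒ ξ₀ ≠ 0`. [folklore] -/
theorem ne_zero_of_valued_eq_one : ξ₀ ≠ 0 := by
  intro h0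
  rw [h0, map_zero, map_zero] at hξ1
  exact zero_ne_one hξ1

include hξ1 hξN in
/-- **VALUATION CURRENCY ⇒ ALGEBRAIC NON-NORM.**  If `|ξ₀|_w = 1` and `|σ_w(u)·u − ξ₀|_w = 1` for every unit `u` of `L_w` (★ (U5) `RamifiedPlaceUnitNorms` currency), then
`ι(ξ₀) ∈ L ⊗ L⁺_v` is NOT of the form `(c ⊗ 1)(z)·z` with `z` a unit (the currency of ★ `exists_norm_mul_of_not_exists_norm`): read the identity at `w`
(★ `conjLocal_apply_eq_of_smul_eq`), `|z_w|² = 1` forces `|z_w| = 1`, and then `|σ_w(z_w) z_w − ξ₀|_w = |0| = 0 ≠ 1`. [cite: Serre1979, Ch. V §3 Prop. 5] [cite: Omeara1963, §63B Prop. 63:13] -/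
theorem not_exists_norm_algebraMap_of_valued :
    ¬ ∃ z : LocalRing L v, IsUnit z ∧ algebraMap L (LocalRing L v) ξ₀ = conjLocal L (IsCMField.complexConj L) v z * z := by
  haveI : Algebra.IsQuadraticExtension ↥(maximalRealSubfield L) L := IsCMField.isQuadraticExtension L
  rintro ⟨z, -, hz⟩
  have h := congrArg (fun t : LocalRing L v => t w) hz
  simp only [Pi.mul_apply] at h
  rw [conjLocal_apply_eq_of_smul_eq (IsCMField.complexConj L) (IsCMField.complexConj_ne_one L) v w hw z] at h
  have hξw : (algebraMap L (LocalRing L v) ξ₀) w = algebraMap L (w.1.adicCompletion L) ξ₀ := rfl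
  rw [hξw] at h
  -- `|z_w|² = 1`
  have hval : Valued.v (z w) * Valued.v (z w) = 1 := by
    have h' := congrArg Valued.v h
    rw [hξ1, map_mul, valued_galAdicCompletionMap] at h'
    exact h'.symm
  have hz1 : Valued.v (z w) = 1 := by
    by_cases hz0 : Valued.v (z w) = 0
    · rw [hz0, mul_zero] at hval
      exact absurd hval zero_ne_one
    · obtain ⟨n, hn⟩ : ∃ n : ℤ, Valued.v (z w) = WithZero.exp n := ⟨_, (WithZero.exp_log hz0).symm⟩
      rw [hn, ← WithZero.exp_add, ← WithZero.exp_zero] at hval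
      have hn0 := WithZero.exp_injective hval
      rw [hn, show n = 0 by omega, WithZero.exp_zero]
  have h1 := hξN (z w) hz1
  rw [← h, sub_self, map_zero] at h1
  exact zero_ne_one h1

include hw hξ1 hξN in
/-- **BLOCK RESCALING BY NORM INDEX TWO.**  For a `σ`-fixed unit `g` of `L ⊗ L⁺_v` (`v` non-split, `ξ₀ ∈ L⁺` a global unit non-norm at `w`) there are a unit `s` and a GLOBAL
`c ∈ {1, ξ₀} ⊂ L⁺` with `σ(s)·g·s = ι(c)`: either `g = N(z)` (`c = 1`) or, the non-norm classes being ONE coset (★ `exists_norm_mul_of_not_exists_norm`), `g = N(z)·ι(ξ₀)`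
(`c = ξ₀`); `s := z⁻¹`. [cite: Rogawski1990, §3.5 Prop. 3.5.2 (a) p. 29] [cite: Omeara1963, §63B Prop. 63:13] [cite: Serre1979, Ch. V §3 Cor. 2] -/
theorem exists_rescale_of_conjLocal_eq (hξc : IsCMField.complexConj L ξ₀ = ξ₀) {g : LocalRing L v} (hgσ : conjLocal L (IsCMField.complexConj L) v g = g) (hgu : IsUnit g) :
    ∃ (s : LocalRing L v) (c : L), IsUnit s ∧ IsCMField.complexConj L c = c ∧ c ≠ 0 ∧ (c = 1 ∨ c = ξ₀) ∧
      algebraMap L (LocalRing L v) c = conjLocal L (IsCMField.complexConj L) v s * g * s := by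
  classical
  haveI : Algebra.IsQuadraticExtension ↥(maximalRealSubfield L) L := IsCMField.isQuadraticExtension L
  set σ := conjLocal L (IsCMField.complexConj L) v with hσdef
  -- an anti-fixed non-zero `δ ∈ L` (the currency of ★ `exists_norm_mul_of_not_exists_norm`)
  obtain ⟨δ, hcδ, hδ⟩ : ∃ d : L, IsCMField.complexConj L d = -d ∧ d ≠ 0 := by
    have hne : IsCMField.complexConj L ≠ 1 := IsCMField.complexConj_ne_one L
    obtain ⟨t, ht⟩ : ∃ t : L, IsCMField.complexConj L t ≠ t := by
      by_contra hall
      exact hne (AlgEquiv.ext fun t => not_not.mp (not_exists.mp hall t))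
    refine ⟨t - IsCMField.complexConj L t, ?_, sub_ne_zero.2 (Ne.symm ht)⟩
    rw [map_sub, IsCMField.complexConj_apply_apply, neg_sub]
  by_cases hg : ∃ z : LocalRing L v, IsUnit z ∧ g = σ z * z
  · obtain ⟨z, hzu, hz⟩ := hg
    refine ⟨↑(hzu.unit⁻¹), 1, (hzu.unit⁻¹).isUnit, map_one _, one_ne_zero, Or.inl rfl, ?_⟩
    have h3 : z * ↑(hzu.unit⁻¹) = 1 := hzu.mul_val_inv
    have h4 : σ z * σ ↑(hzu.unit⁻¹) = 1 := by rw [← map_mul, h3, map_one]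
    rw [map_one, hz]
    have e : σ ↑(hzu.unit⁻¹) * (σ z * z) * ↑(hzu.unit⁻¹) = (σ z * σ ↑(hzu.unit⁻¹)) * (z * ↑(hzu.unit⁻¹)) := by ring
    rw [e, h3, h4, mul_one]
  · have hξ0 : ξ₀ ≠ 0 := ne_zero_of_valued_eq_one L v w hξ1
    have hξσ : σ (algebraMap L (LocalRing L v) ξ₀) = algebraMap L (LocalRing L v) ξ₀ := by
      rw [hσdef, Literature.NumberTheory.Rogawski1990.conjLocal_algebraMap, hξc]
    have hξu : IsUnit (algebraMap L (LocalRing L v) ξ₀) := (IsUnit.mk0 ξ₀ hξ0).map _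
    have hξnn := not_exists_norm_algebraMap_of_valued L v w hw hξ1 hξN
    obtain ⟨z, hzu, hz⟩ := exists_norm_mul_of_not_exists_norm L v (IsCMField.complexConj L) hcδ hδ w hw hξσ hξu hgσ hgu hξnn hg
    refine ⟨↑(hzu.unit⁻¹), ξ₀, (hzu.unit⁻¹).isUnit, hξc, hξ0, Or.inr rfl, ?_⟩
    have h3 : z * ↑(hzu.unit⁻¹) = 1 := hzu.mul_val_inv
    have h4 : σ z * σ ↑(hzu.unit⁻¹) = 1 := by rw [← map_mul, h3, map_one]
    rw [hz]
    have e : σ ↑(hzu.unit⁻¹) * (σ z * z * algebraMap L (LocalRing L v) ξ₀) * ↑(hzu.unit⁻¹) =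
        algebraMap L (LocalRing L v) ξ₀ * ((σ z * σ ↑(hzu.unit⁻¹)) * (z * ↑(hzu.unit⁻¹))) := by ring
    rw [e, h3, h4, mul_one, mul_one]

omit [IsCMField L] in
/-- The local images of the scaled split forms: `(c • Φ₂)_v = (0 c; c 0)`, `(c • Φ₁)_v = (c)`. [cite: Rogawski1990, §4.8 Case (a) p. 53] -/
theorem map_smul_antidiagOne_two_one (c₂ c₁ : L) :
    (c₂ • (Matrix.of fun i j : Fin 2 => if i.val + j.val + 1 = 2 then (1 : L) else 0)).map (algebraMap L (LocalRing L v)) =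
        !![0, algebraMap L (LocalRing L v) c₂; algebraMap L (LocalRing L v) c₂, 0] ∧
      (c₁ • (Matrix.of fun i j : Fin 1 => if i.val + j.val + 1 = 1 then (1 : L) else 0)).map (algebraMap L (LocalRing L v)) =
        !![algebraMap L (LocalRing L v) c₁] := by
  constructor
  · ext i j
    fin_cases i <;> fin_cases j <;> simp [Matrix.map_apply]
  · ext i j
    fin_cases i; fin_cases j
    simp [Matrix.map_apply]

end Place

/-! ## §3 The dock block model at a ramified odd place (global unit non-norm `ξ₀`) -/

section Dock

/-- **(D-a-ram) «DOCK BLOCK MODEL AT A RAMIFIED ODD PLACE».**  The (D-a) contract `exists_blockModel_dock` of K2E3-p15 (g3)'s letter D with `hunr` traded for a global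
`ξ₀ ∈ L⁺` that is a unit and not a norm at `w` (`hξc hξ1 hξN`, the ★ S4 (r) ∕ ★ (U5) currency): from the central point `ε_H = (a·1₂, u)` (`ha`, `u ≠ a`), a central dock
`θ : H_v ≃ₜ* Z(ε)` with `θ ε_H = ε` and `↑(θ z) = y·ι_v(z)·y⁻¹`, at a non-split `v` (`c • w = w`) — GLOBAL `c₂, c₁ ∈ {1, ξ₀}` (non-zero, `complexConj`-fixed), a congruence
`T ∈ GL₃(L ⊗ L⁺_v)` of scalar `1` from `H′_v` to `(c₂Φ₂ ⊕ᶠ c₁Φ₁)_v`, the block-scalar point `x = φ_T⁻¹ ε` (`mat x = a·1₂ ⊕ᶠ u·1₁`, `a − u` a unit, `φ_T x = ε`), and the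
INTERTWINING `mat g = z.1 ⊕ᶠ z.2 → φ_T g = ↑(θ z)` — the hypotheses `(hc₂ hc₁ hc₂c hc₁c T hT x hau hx hxε hinter)` of (D-b) `measure_level_prod_univ_eq_of_dockBlockModel`.
`T = y · ι(s₂·1₂, s₁)·W` with `σ(s₂)λs₂ = c₂`, `σ(s₁)μs₁ = c₁` for the dock scalars `λ, μ` of ★ F3a. [cite: Rogawski1990, §4.8 Case (a) p. 53; §8.1 p. 116; §3.5 Prop. 3.5.2 (a) p. 29]
[cite: PlatonovRapinchuk1994, §2.3] [cite: Omeara1963, §63B Prop. 63:13] [cite: Serre1979, Ch. V §3 Cor. 2] -/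
theorem exists_blockModel_dock_ramified (L : Type) [Field L] [NumberField L] [IsCMField L] (H' : Matrix (Fin 3) (Fin 3) L)
    (hherm : (H'.map (cmConjRingHom L))ᵀ = H') (hanis : ∀ x : Fin 3 → L, Literature.AlgebraicGeometry.ShimuraVarieties.hermForm (cmConjRingHom L) H' x x = 0 → x = 0)
    (v : HeightOneSpectrum (𝓞 ↥(maximalRealSubfield L))) (w : PlacesOver L v) (hw : IsCMField.complexConj L • w.1 = w.1)
    (ξ₀ : L) (hξc : IsCMField.complexConj L ξ₀ = ξ₀) (hξ1 : Valued.v (algebraMap L (w.1.adicCompletion L) ξ₀) = 1)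
    (hξN : ∀ u : w.1.adicCompletion L, Valued.v u = 1 →
      Valued.v (galAdicCompletionMap (L := L) (IsCMField.complexConj L) hw u * u - algebraMap L (w.1.adicCompletion L) ξ₀) = 1)
    (εH : ((cmDatum L 2 (Matrix.of fun i j : Fin 2 => if i.val + j.val + 1 = 2 then (1 : L) else 0)).Local v ×
      (cmDatum L 1 (Matrix.of fun i j : Fin 1 => if i.val + j.val + 1 = 1 then (1 : L) else 0)).Local v)) (a : LocalRing L v)
    (ha : (εH.1.val.val : Matrix (Fin 2) (Fin 2) (LocalRing L v)) = a • (1 : Matrix (Fin 2) (Fin 2) (LocalRing L v)))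
    (hu : (εH.2.val.val : Matrix (Fin 1) (Fin 1) (LocalRing L v)) 0 0 ≠ a)
    {ε : (cmDatum L 3 H').Local v} {y : GL (Fin 3) (LocalRing L v)}
    (θ : ((cmDatum L 2 (Matrix.of fun i j : Fin 2 => if i.val + j.val + 1 = 2 then (1 : L) else 0)).Local v ×
      (cmDatum L 1 (Matrix.of fun i j : Fin 1 => if i.val + j.val + 1 = 1 then (1 : L) else 0)).Local v) ≃ₜ* ↥(Subgroup.centralizer ({ε} : Set ((cmDatum L 3 H').Local v))))
    (hε : (θ εH).1 = ε)
    (hθ : ∀ z : ((cmDatum L 2 (Matrix.of fun i j : Fin 2 => if i.val + j.val + 1 = 2 then (1 : L) else 0)).Local v ×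
      (cmDatum L 1 (Matrix.of fun i j : Fin 1 => if i.val + j.val + 1 = 1 then (1 : L) else 0)).Local v),
      (((θ z).1).val : GL (Fin 3) (LocalRing L v)) = y * ((endoEmbLocal L v z).val : GL (Fin 3) (LocalRing L v)) * y⁻¹) :
    ∃ (c₂ c₁ : L), c₂ ≠ 0 ∧ c₁ ≠ 0 ∧ IsCMField.complexConj L c₂ = c₂ ∧ IsCMField.complexConj L c₁ = c₁ ∧ (c₂ = 1 ∨ c₂ = ξ₀) ∧ (c₁ = 1 ∨ c₁ = ξ₀) ∧
      ∃ (T : GL (Fin (2 + 1)) (LocalRing L v))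
        (hT : formCongr (conjLocal L (IsCMField.complexConj L) v) T (H'.map (algebraMap L (LocalRing L v))) =
          (1 : LocalRing L v) • (finSum 2 1 (c₂ • (Matrix.of fun i j : Fin 2 => if i.val + j.val + 1 = 2 then (1 : L) else 0))
            (c₁ • (Matrix.of fun i j : Fin 1 => if i.val + j.val + 1 = 1 then (1 : L) else 0))).map (algebraMap L (LocalRing L v)))
        (x : (cmDatum L (2 + 1) (finSum 2 1 (c₂ • (Matrix.of fun i j : Fin 2 => if i.val + j.val + 1 = 2 then (1 : L) else 0))
            (c₁ • (Matrix.of fun i j : Fin 1 => if i.val + j.val + 1 = 1 then (1 : L) else 0)))).Local v),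
        IsUnit (a - (εH.2.val.val : Matrix (Fin 1) (Fin 1) (LocalRing L v)) 0 0) ∧
        mat L (2 + 1) (finSum 2 1 (c₂ • (Matrix.of fun i j : Fin 2 => if i.val + j.val + 1 = 2 then (1 : L) else 0))
            (c₁ • (Matrix.of fun i j : Fin 1 => if i.val + j.val + 1 = 1 then (1 : L) else 0))) v x =
          finSum 2 1 (a • (1 : Matrix (Fin 2) (Fin 2) (LocalRing L v)))
            (((εH.2.val.val : Matrix (Fin 1) (Fin 1) (LocalRing L v)) 0 0) • (1 : Matrix (Fin 1) (Fin 1) (LocalRing L v))) ∧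
        cmDatumLocalCongr L v T isUnit_one hT x = ε ∧
        ∀ (z : ((cmDatum L 2 (Matrix.of fun i j : Fin 2 => if i.val + j.val + 1 = 2 then (1 : L) else 0)).Local v ×
            (cmDatum L 1 (Matrix.of fun i j : Fin 1 => if i.val + j.val + 1 = 1 then (1 : L) else 0)).Local v))
          (g : (cmDatum L (2 + 1) (finSum 2 1 (c₂ • (Matrix.of fun i j : Fin 2 => if i.val + j.val + 1 = 2 then (1 : L) else 0))
            (c₁ • (Matrix.of fun i j : Fin 1 => if i.val + j.val + 1 = 1 then (1 : L) else 0)))).Local v),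
          mat L (2 + 1) (finSum 2 1 (c₂ • (Matrix.of fun i j : Fin 2 => if i.val + j.val + 1 = 2 then (1 : L) else 0))
              (c₁ • (Matrix.of fun i j : Fin 1 => if i.val + j.val + 1 = 1 then (1 : L) else 0))) v g =
            finSum 2 1 (z.1.val.val : Matrix (Fin 2) (Fin 2) (LocalRing L v)) (z.2.val.val : Matrix (Fin 1) (Fin 1) (LocalRing L v)) →
          cmDatumLocalCongr L v T isUnit_one hT g = ((θ z).1 : (cmDatum L 3 H').Local v) := by
  classical
  haveI : Algebra.IsQuadraticExtension ↥(maximalRealSubfield L) L := IsCMField.isQuadraticExtension L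
  set σ := conjLocal L (IsCMField.complexConj L) v with hσdef
  -- (1) F3a: `ᵗ(σy)·H′_v·y = (0 0 λ; 0 μ 0; λ 0 0)`, `σλ = λ`, `σμ = μ`
  obtain ⟨lam, mu, hlam, hmu, hyG⟩ :=
    K2E3DockInvariantForm.exists_formCongr_dock_eq L H' v hherm θ (fun t => (t : (cmDatum L 3 H').Local v)) y hθ
  have hHv : (adelicForm L 3 H').map (adeleToLocal L v) = H'.map (algebraMap L (LocalRing L v)) :=
    Literature.NumberTheory.Rogawski1990.adelicForm_map_adeleToLocal L v H'
  rw [hHv] at hyG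
  -- (2) `λ, μ` are units (`det H′ ≠ 0`)
  have hdet' : H'.det ≠ 0 := Godement.det_ne_zero_of_anisotropic L H' hanis
  have hHvd : IsUnit (H'.map (algebraMap L (LocalRing L v))).det := by
    rw [← hHv]; exact UnitaryGroup.isUnit_det_localForm L 3 H' v hdet'
  have hGd : IsUnit (formCongr σ y (H'.map (algebraMap L (LocalRing L v)))).det := isUnit_det_formCongr σ y hHvd
  rw [hyG] at hGd
  obtain ⟨hlu, hmuu⟩ := isUnit_dockForm_entries hGd
  -- (3) block rescaling by norm index two: `σ(s₂)λs₂ = ι c₂`, `σ(s₁)μs₁ = ι c₁`, `cᵢ ∈ {1, ξ₀}`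
  obtain ⟨s₂, c₂, hs₂, hc₂c, hc₂0, hc₂m, hc₂loc⟩ := exists_rescale_of_conjLocal_eq L v w hw hξ1 hξN hξc hlam hlu
  obtain ⟨s₁, c₁, hs₁, hc₁c, hc₁0, hc₁m, hc₁loc⟩ := exists_rescale_of_conjLocal_eq L v w hw hξ1 hξN hξc hmu hmuu
  obtain ⟨t₂, ht₂⟩ := hs₂.exists_right_inv
  obtain ⟨t₁, ht₁⟩ := hs₁.exists_right_inv
  -- the rescaling unit `M = ι(s₂·1₂, s₁)·W`
  obtain ⟨M, hM, hMi⟩ : ∃ M : GL (Fin 3) (LocalRing L v), M.val = !![s₂, 0, 0; 0, 0, s₁; 0, s₂, 0] ∧ (M⁻¹).val = !![t₂, 0, 0; 0, 0, t₂; 0, t₁, 0] :=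
    ⟨⟨_, _, rescale_mul_rescaleInv ht₂ ht₁, rescaleInv_mul_rescale ht₂ ht₁⟩, rfl, rfl⟩
  -- (4) the congruence `T := y·M` of scalar `1` onto `(c₂Φ₂ ⊕ᶠ c₁Φ₁)_v`
  obtain ⟨hB, hC⟩ := map_smul_antidiagOne_two_one L v c₂ c₁
  have hT : formCongr σ (y * M) (H'.map (algebraMap L (LocalRing L v))) =
      (1 : LocalRing L v) • (finSum 2 1 (c₂ • (Matrix.of fun i j : Fin 2 => if i.val + j.val + 1 = 2 then (1 : L) else 0))
        (c₁ • (Matrix.of fun i j : Fin 1 => if i.val + j.val + 1 = 1 then (1 : L) else 0))).map (algebraMap L (LocalRing L v)) := by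
    rw [formCongr_mul_eq, hyG, one_smul, finSum_map, hB, hC, finSum_antidiag_two_one, hM, transpose_map_rescale_mul_dockForm_mul_rescale σ s₂ s₁ lam mu,
      ← hc₂loc, ← hc₁loc]
  -- (5) the block-scalar preimage `x := φ_T⁻¹ ε`
  set φ := cmDatumLocalCongr L v (y * M) isUnit_one hT with hφdef
  have hεv : (ε.val : GL (Fin 3) (LocalRing L v)) = y * ((endoEmbLocal L v εH).val : GL (Fin 3) (LocalRing L v)) * y⁻¹ := by
    rw [← hε]; exact hθ εH
  have hconj : (y * M) * (φ.symm ε).val * (y * M)⁻¹ = ε.val := by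
    rw [← coe_cmDatumLocalCongr_apply L v (y * M) isUnit_one hT (φ.symm ε)]
    exact congrArg Subtype.val (φ.apply_symm_apply ε)
  have hx1 := eq_conj_of_frame_conj_eq hconj hεv
  have hιε : ((((endoEmbLocal L v εH).val : GL (Fin 3) (LocalRing L v))).val : Matrix (Fin 3) (Fin 3) (LocalRing L v)) =
      !![a, 0, 0; 0, (εH.2.val.val : Matrix (Fin 1) (Fin 1) (LocalRing L v)) 0 0, 0; 0, 0, a] :=
    coe_coe_endoEmbLocal_of_fst_eq_smul_one L v εH a ha
  have hxmat : mat L (2 + 1) (finSum 2 1 (c₂ • (Matrix.of fun i j : Fin 2 => if i.val + j.val + 1 = 2 then (1 : L) else 0))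
      (c₁ • (Matrix.of fun i j : Fin 1 => if i.val + j.val + 1 = 1 then (1 : L) else 0))) v (φ.symm ε) =
      finSum 2 1 (a • (1 : Matrix (Fin 2) (Fin 2) (LocalRing L v)))
        (((εH.2.val.val : Matrix (Fin 1) (Fin 1) (LocalRing L v)) 0 0) • (1 : Matrix (Fin 1) (Fin 1) (LocalRing L v))) := by
    rw [mat_def, hx1, Units.val_mul, Units.val_mul, hMi, hM, hιε, finSum_smul_one_smul_one]
    exact rescaleInv_mul_diagonal_mul_rescale ht₂ ht₁ a _
  -- (6) assemble; the intertwining `φ_T g = ↑(θ z)` for `mat g = z.1 ⊕ᶠ z.2`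
  refine ⟨c₂, c₁, hc₂0, hc₁0, hc₂c, hc₁c, hc₂m, hc₁m, y * M, hT, φ.symm ε, isUnit_sub_of_ne_of_smul_eq L v w hw hu, hxmat, φ.apply_symm_apply ε, ?_⟩
  intro z g hg
  apply Subtype.ext
  have hgm : (((g.val : GL (Fin 3) (LocalRing L v))).val : Matrix (Fin 3) (Fin 3) (LocalRing L v)) =
      finSum 2 1 (z.1.val.val : Matrix (Fin 2) (Fin 2) (LocalRing L v)) (z.2.val.val : Matrix (Fin 1) (Fin 1) (LocalRing L v)) := hg
  have hMg : M * (g.val : GL (Fin 3) (LocalRing L v)) * M⁻¹ = ((endoEmbLocal L v z).val : GL (Fin 3) (LocalRing L v)) := by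
    apply Units.ext
    rw [Units.val_mul, Units.val_mul, hM, hMi, hgm, coe_endoEmbLocal, coe_endoGL_eq]
    exact rescale_mul_finSum_mul_rescaleInv ht₂ ht₁ _ _
  have hφg : ((φ g).val : GL (Fin 3) (LocalRing L v)) = (y * M) * (g.val : GL (Fin 3) (LocalRing L v)) * (y * M)⁻¹ :=
    coe_cmDatumLocalCongr_apply L v (y * M) isUnit_one hT g
  rw [hφg, frame_mul_conj_eq y M (g.val : GL (Fin 3) (LocalRing L v)), hMg, hθ z]

end Dock

end Summit.HodgeConjecture.HodgeConjecture.Cruxes.H413.K2E3DockBlockModelRamified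

end
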